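import Summits.FinalStateConjecture.FinalStateConjecture.Theses.SwallowTheDatum
import Summits.FinalStateConjecture.FinalStateConjecture.Theorems.KerrShieldedDataExist.Negative.BentSliceConormal
import Literature.Geometry.Lorentzian.CauchyDevelopmentRestrict
import Literature.Geometry.Lorentzian.GeodesicExtension
import Literature.Geometry.Lorentzian.KerrDataProofs
import HarnessLib

/-!
# Line `two-speed-optics-sojourn` for crux `KerrShieldedSettles` (stmt-FinalStateConjecture-10054)

Crux-plan skeleton (planner-cruxplan-stmt-FinalStateConjecture-10054-two-speed-optics-soj-0, 2026-08-16).
Idea card `Cruxes/KerrShieldedSettles/Ideas/two-speed-optics-sojourn.md` (≈ `speed-limit-energy-floor`, triage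
merge M2); line card `Lines/two-speed-optics-sojourn.md`.

THE LINE.  A Kerr-shielded admissible datum `D` on `X` is, outside the compact core, the exact bent leaf
`Σᵉ = {t* = T_{M,a}(r), r > r₁}` of sub-extremal Kerr in ingoing Kerr–Schild coordinates (`ψ = Negative.graph`,
pinned by the crux's graph clause).  (W) A thin tapered collar `W ⊇ {t* ≥ T(r)}` of the chart in which `Σᵉ` is a
Cauchy hypersurface makes `(W, g_{M,a})` a vacuum Cauchy development `𝒲` of the exact slice data `D.comap φ`
(`stub_shieldCollar` + `stub_kerrRicciFlat`, assembled here with the tree's `DataEmbedding.restrict`); the route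
item `SubdataDevelopmentsEmbed` (10053, taken BY NAME as the one admissible hypothesis of the composition) embeds
`𝒲` into every maximal development `𝒟` over `φ`.  (A — this card's engine) In `W`, TWO POINTWISE, spin-independent
inequalities of the Kerr–Schild form `g = η + 2Hℓ⊗ℓ` (`stub_twoSpeedOptics`: outer cone / speed limit `|v⃗| ≤ v⁰`,
INNER cone of chart speed `(r−2M)/(r+2M)`, Killing-energy PINCH `(1−4H)v⁰ ≤ E ≤ v⁰`), the conserved Killing energy
and a general escape lemma (`stub_escape`) give far-region sojourn completeness of `(W, Σᵉ)` with explicit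
radial fronts and the clock bound `ṫ* ≤ 2E` on `{r ≥ 8M}` — `stub_kerrSojourn`, the HARDEST stub; it is
transported to `𝒟` along `χ` and capped at the inner edge using admissibility (`stub_sojournTransport`) — clause
`HasCompleteNullInfinity`.  (B/C) The `N = 1` receding-bend charts and the `∀τ₁` covering inside `χ(W)` plus the
last-exit identification of `exteriorOf` (`stub_exteriorCharts` = the sibling line `one-gauge-sliding-seam` /
Disproof §C1/§C3/§F; not this card's engine, stated whole).

DISPROOF USED (`Cruxes/KerrShieldedSettles/Disproof.lean` rev 4): no `_false_without_` theorem exists (§A/§D);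
§H1 (admissibility load-bearing) is honoured — completeness / `IsSoleEnd` is consumed exactly once, in the
inner-edge capping inside `stub_sojournTransport`; §C2/§I (no sharp radial ledger for `a ≠ 0`) — the sojourn stub
bounds the CLOCK `ṫ* ≤ 2E`, never `ṙ`; §B/§B′/§E (`conormalSq_*_neg`: the leaf is spacelike, `u = t* − T(r)` is a
time function) enter `stub_shieldCollar`/`stub_kerrSojourn`; the landed Negative lemma
`Theorems/KerrShieldedSettles/Negative/StationaryBendDead.lean` (`not_tendsto_stationaryBend_dev`; read, not imported —
the farm snapshot had it unbuilt at plan time, re-add the import once it is built) is respected by `stub_exteriorCharts`,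
whose hole chart RECEDES (`bentHeight_le_two_mul_log`); `not_exists_unbent_bound` likewise (all charts bent); the
sibling lane `KerrShieldedDataExist/Negative/*` IS imported (`psi_eq_graph`, `bentHeight`, `conormalForm_bentSlope_neg`).  `ledger negatives --problem FinalStateConjecture` = 0 (2026-08-16).

Composition `KerrShieldedSettles_of (hSub : SubdataDevelopmentsEmbed) : KerrShieldedSettles` has no `sorry` of its
own: pin `ψ`, injectivity of `dφ` from the pull-back identity, collar, data embedding on the chart, restriction,
vacuum Cauchy development, `χ` from `hSub`, then the two clause stubs.
-/

set_option linter.dupNamespace false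

noncomputable section

open Set Function Filter Topology Bundle
open scoped Manifold ContDiff Topology ENNReal
open Literature.Geometry.Lorentzian
open Summit.FinalStateConjecture.FinalStateConjecture.Theorems.KerrShieldedDataExist.Negative
  (bentHeight bentHeight_eq_literal graph coe_graph psi_eq_graph radius_ofTimeSpace)

namespace Summit.FinalStateConjecture.FinalStateConjecture.Cruxes.KerrShieldedSettles.TwoSpeedOpticsSojourn

/-! ## Objects of the line (definitions, no obligations) -/

/-- The **future of the bent leaf in the chart**: `{x ∈ Kerr.region a r₁ | t*(x) ≥ T_{M,a}(r(x))}` (`u ≥ 0`). -/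
def leafFuture (M a r₁ : ℝ) : Set (Kerr.region a r₁) :=
  {x | bentHeight M a (Kerr.radius a x.1) ≤ x.1 0}

/-- The open sub-spacetime `(W, g_{M,a}|_W, −g♯dt*|_W)` of the Kerr chart on an open connected `W`. -/
abbrev collarSpacetime [Kerr.Facts] (M a r₁ : ℝ) (hM : 0 ≤ M) (W : TopologicalSpace.Opens (Kerr.region a r₁))
    (hW : IsConnected (W : Set (Kerr.region a r₁))) : Spacetime 4 :=
  (Kerr.spacetime M a r₁ hM).restrict PseudoRiemannianMetric.contMDiff_restrict_holds
    (Kerr.spacetime M a r₁ hM).timeOrientation.contMDiff_restrict_holds W hW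

/-- The bent leaf as a map into `W` (the embedding of the exact slice data into the collar development). -/
def leafEmbed (M a r₁ : ℝ) (W : TopologicalSpace.Opens (Kerr.region a r₁)) (hι : ∀ y, graph M a r₁ y ∈ W) :
    Kerr.slice a r₁ → W :=
  fun y ↦ ⟨graph M a r₁ y, hι y⟩

/-- The far annulus `{R₀ ≤ ‖y‖ ≤ R₀ + 1}` of the slice (the set `B₀` of the sojourn clause, before `φ`). -/
def farAnnulus (a r₁ R₀ : ℝ) : Set (Kerr.slice a r₁) :=
  {y | R₀ ≤ ‖(y : E3)‖ ∧ ‖(y : E3)‖ ≤ R₀ + 1}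

/-! ## The seven registered stubs -/

/-- **Stub 1 — two-speed Kerr–Schild optics (the card's LEVER; pointwise algebra, every spin).**  For
`g = η + 2Hℓ⊗ℓ` (`Kerr.bilin`, `ℓ = (1, ℓ⃗)`, `|ℓ⃗| = 1` by `Kerr.nullCovector_nullVector`, `0 ≤ H ≤ M/r` by
`Kerr.scalarH_nonneg`/`Kerr.scalarH_le_div`) at a point with `r > 0`, `M ≥ 0`, and a vector `v` with `v⁰ ≥ 0`:
(i) OUTER CONE / speed limit: `g(v,v) ≤ 0 ⇒ |v⃗| ≤ v⁰` (`g(v,v) = −(v⁰)² + |v⃗|² + 2Hℓ(v)²`);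
(ii) INNER CONE: on `r > 2M`, `(r+2M)|v⃗| < (r−2M)v⁰ ⇒ g(v,v) < 0`
(`g(v,v) ≤ (v⁰+|v⃗|)((2H−1)v⁰ + (1+2H)|v⃗|)` and `(1−2H)/(1+2H) ≥ (r−2M)/(r+2M)`);
(iii) ENERGY PINCH: `g(v,v) = 0 ⇒ (1−4H)v⁰ ≤ E ≤ v⁰` for the Killing energy `E = −g(v, ∂_{t*}) = v⁰ − 2Hℓ(v)`,
`ℓ(v) ∈ [0, 2v⁰]`.  Degenerate cases `M = 0`, `v = 0` hold trivially.  Numerically re-derived by all three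
triagers (0 violations in > 4·10⁴ samples, `|a| ≤ .999M`).  Size M.
[cite: KerrSchild1965, §2] [cite: arXiv08110354, §5.1] -/
theorem stub_twoSpeedOptics :
    ∀ {M a : ℝ}, 0 ≤ M → ∀ (x : E4), 0 < Kerr.radius a x → ∀ (v : E4), 0 ≤ v 0 →
      (Kerr.bilin M a x v v ≤ 0 → E4.spatialNorm v ≤ v 0) ∧
      (2 * M < Kerr.radius a x →
        (Kerr.radius a x + 2 * M) * E4.spatialNorm v < (Kerr.radius a x - 2 * M) * v 0 →
          Kerr.bilin M a x v v < 0) ∧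
      (Kerr.bilin M a x v v = 0 →
        (1 - 4 * Kerr.scalarH M a x) * v 0 ≤ -Kerr.bilin M a x v (E4.basisVector 0) ∧
          -Kerr.bilin M a x v (E4.basisVector 0) ≤ v 0) := by
  sorry

/-- **Stub 2 — escape lemma (general; triage sharpen S2, shared by every sojourn card).**  A geodesic of a `C¹`
connection on a Hausdorff boundaryless manifold (modelled on `E4`), defined on `(a, b)`, whose tangent lifts on
`[t₀, b)` stay in a COMPACT subset of the tangent bundle, extends as a geodesic beyond `b`: uniform existence time
`ε` on the compact set (`exists_uniform_isGeodesicOn_of_isCompact`, GeodesicUniformTime) applied at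
`t₁ = b − ε/2` and glued with `IsGeodesicOn.exists_extend` (GeodesicExtension).  O'Neill 1983, Ch. 5, Lemma 8;
Lee 2018, Lemma 6.19 ("escape lemma").  Size M.  [cite: ONeill1983, Ch. 5, Lemma 8] -/
theorem stub_escape :
    ∀ {M : Type} [TopologicalSpace M] [ChartedSpace E4 M] [IsManifold 𝓘(ℝ, E4) ∞ M] [T2Space M]
      [BoundarylessManifold 𝓘(ℝ, E4) M]
      {cov : CovariantDerivative 𝓘(ℝ, E4) E4 (TangentSpace 𝓘(ℝ, E4) : M → Type _)}
      [CovariantDerivative.ContMDiffCovariantDerivative cov 1]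
      {γ : ℝ → M} {a b t₀ : ℝ}, t₀ ∈ Ioo a b → IsGeodesicOn cov γ (Ioo a b) →
      ∀ {𝒦 : Set (TangentBundle 𝓘(ℝ, E4) M)}, IsCompact 𝒦 →
        (∀ t ∈ Ico t₀ b, tangentLift 𝓘(ℝ, E4) γ t ∈ 𝒦) →
        ∃ ε > (0 : ℝ), ∃ γ' : ℝ → M, IsGeodesicOn cov γ' (Ioo a (b + ε)) ∧ EqOn γ' γ (Ioo a b) := by
  sorry

/-- **Stub 3 — far-region sojourn completeness of exact Kerr above the bent leaf (HARDEST; the card's five-step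
architecture, given Stubs 1–2).**  For sub-extremal `(M, a)`, `r₋ < r₁ < r₊`, ANY open connected `W` of the chart
`{r > r₁}` containing `{t* ≥ T(r)}`, and any future unit normal `ν` of the leaf `ψ = graph M a r₁`: there is `R₀`
(far annulus `B₀ = {R₀ ≤ ‖y‖ ≤ R₀+1}`, compact in the slice) such that for every `s > 0` some `R₁` works — every
normalised future null ray of `(W, g|_W)` from a leaf point `ψ(p)`, `‖p‖ ≥ R₁`, maximal IN `W`, is future complete
or spends affine time `≥ s` in `J⁺_W(ψB₀)`.  Proof plan (card + TRIAGE r2): Killing energy `E = −g(γ̇, ∂_{t*})` is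
constant (momentum ODE `OpensChart.hasDerivAt_momentum_of_isGeodesicOn` with `∂₀ g = 0`,
`Kerr.fderiv_bilin_basisVector_zero`); by Stub 1 on `{r ≥ 8M}` (`4H ≤ ½`): `E ≤ ṫ* ≤ 2E`, `|ẏ| ≤ ṫ*`, and
`E ∈ [0.92, 0.98] ⊂ [½, 1.26]` from the normalisation against `ν` at `r ≥ 16M` (`N = √(−conormalSq) ≤ 1.08`,
`T′ ≤ 0.15`: `Negative.conormalForm_bentSlope_neg`, `bentSlope_le`); ESCAPE DICHOTOMY: while `r ≥ 8M` the 1-jet is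
in a compact subset of `TW` (positions in `{8M ≤ r ≤ R, 0 ≤ u, t* ≤ T*} ⊂ W` since `u = t* − T(r)` is a time
function, `conormalSq_*_neg`; velocities bounded), so by Stub 2 + maximality in `W` either `¬ BddAbove dom` or
`r` reaches `8M` at some `λ₁`; ENTRY: before that, `t*(λ) − T(r_p) ≥ ‖y(λ) − y_p‖` puts the ray into
`F = {‖y‖ ≥ R₀', t* ≥ t₀ + σ(‖y‖)} ⊆ J⁺_W(ψB₀)` (explicit rise–drift–rise causal curves at chart speed
`κ̃(ρ) = (ρ−|a|−3M)/(ρ+3M) < κ(r)`, Stub 1 (ii), corner rounding as in `CausalCurveGluing`;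
`σ(ρ) ≤ (ρ − R₀') + 7M log(ρ/M)`) no later than radius `ρ_e ≥ (ρ_p + R₀')/2 − 3.5M log(ρ_p/M)`, and
`J⁺` is future-hereditary (`causalFuture_trans_holds`); BANKING: from `ρ_e` to `r = 8M` takes affine time
`≥ (ρ_e − 9M)/(2E_max)`, so sojourn `≥ ρ_p/5.2 − 2M log(ρ_p/M) − 4M ≥ s` once `‖p‖ ≥ R₁(s) := 6s + C M log(2+s/M)`.
No radial ledger, no Carter constant, all ray classes at once (T1/L4/L5 of round 1 dissolved).  This is also the
content of the vendored UNPROVED sanity fact `kerr_hasCompleteFutureNullInfinity` (flat leaf) — prove both with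
one engine.  Size XL.  [cite: arXiv08110354, §2.6.2 and §5.1] [cite: Christodoulou1999, pp. A26–A27]
[cite: ONeill1983, Ch. 5, Lemma 8] -/
theorem stub_kerrSojourn :
    -- statement of Stub 1
    (∀ {M a : ℝ}, 0 ≤ M → ∀ (x : E4), 0 < Kerr.radius a x → ∀ (v : E4), 0 ≤ v 0 →
      (Kerr.bilin M a x v v ≤ 0 → E4.spatialNorm v ≤ v 0) ∧
      (2 * M < Kerr.radius a x →
        (Kerr.radius a x + 2 * M) * E4.spatialNorm v < (Kerr.radius a x - 2 * M) * v 0 →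
          Kerr.bilin M a x v v < 0) ∧
      (Kerr.bilin M a x v v = 0 →
        (1 - 4 * Kerr.scalarH M a x) * v 0 ≤ -Kerr.bilin M a x v (E4.basisVector 0) ∧
          -Kerr.bilin M a x v (E4.basisVector 0) ≤ v 0)) →
    -- statement of Stub 2
    (∀ {M : Type} [TopologicalSpace M] [ChartedSpace E4 M] [IsManifold 𝓘(ℝ, E4) ∞ M] [T2Space M]
      [BoundarylessManifold 𝓘(ℝ, E4) M]
      {cov : CovariantDerivative 𝓘(ℝ, E4) E4 (TangentSpace 𝓘(ℝ, E4) : M → Type _)}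
      [CovariantDerivative.ContMDiffCovariantDerivative cov 1]
      {γ : ℝ → M} {a b t₀ : ℝ}, t₀ ∈ Ioo a b → IsGeodesicOn cov γ (Ioo a b) →
      ∀ {𝒦 : Set (TangentBundle 𝓘(ℝ, E4) M)}, IsCompact 𝒦 →
        (∀ t ∈ Ico t₀ b, tangentLift 𝓘(ℝ, E4) γ t ∈ 𝒦) →
        ∃ ε > (0 : ℝ), ∃ γ' : ℝ → M, IsGeodesicOn cov γ' (Ioo a (b + ε)) ∧ EqOn γ' γ (Ioo a b)) →
    ∀ [Kerr.Facts] (M a r₁ : ℝ) (hM : 0 ≤ M), |a| < M → Kerr.rMinus M a < r₁ → r₁ < Kerr.rPlus M a →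
    ∀ (W : TopologicalSpace.Opens (Kerr.region a r₁)) (hW : IsConnected (W : Set (Kerr.region a r₁)))
      (hι : ∀ y, graph M a r₁ y ∈ W), leafFuture M a r₁ ⊆ (W : Set (Kerr.region a r₁)) →
    ∀ (ν : NormalField 𝓘(ℝ, E4) (graph M a r₁)),
      (Kerr.smoothMetric M a r₁).IsFutureUnitNormal 𝓘(ℝ, E3) ((Kerr.timeOrientation M a r₁ hM).ofLE le_top)
        (graph M a r₁) ν →
    ∀ [hLC : (collarSpacetime M a r₁ hM W hW).metric.HasLeviCivita],
    ∃ R₀ : ℝ, IsCompact (farAnnulus a r₁ R₀) ∧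
      ∀ s : ℝ, 0 < s → ∃ R₁ : ℝ, ∀ p : Kerr.slice a r₁, R₁ ≤ ‖(p : E3)‖ →
        ∀ (γ : ℝ → (collarSpacetime M a r₁ hM W hW).carrier) (dom : Set ℝ),
          (collarSpacetime M a r₁ hM W hW).metric.IsNormalisedNullRayFrom
              (collarSpacetime M a r₁ hM W hW).timeOrientation (leafEmbed M a r₁ W hι) (fun y ↦ ν y) p γ dom →
            ¬ BddAbove dom ∨ ENNReal.ofReal s ≤ sojournTime γ dom
              ((collarSpacetime M a r₁ hM W hW).metric.causalFuture
                (collarSpacetime M a r₁ hM W hW).timeOrientation (leafEmbed M a r₁ W hι '' farAnnulus a r₁ R₀)) := by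
  sorry

/-- **Stub 4 — the shield collar (engine of the merged W-cards `tapered-temporal-collar` ≈
`three-clocks-pinched-development` ≈ `pinched-sandwich-cauchy`; sibling line).**  For sub-extremal `(M,a)` and
`r₋ < r₁ < r₊`: the leaf `ψ = graph M a r₁` (`y ↦ (T(r(y)), y)`, `T = bentHeight M a`, smooth by
`contDiff_bentHeight`, spacelike by `conormalSq_inner/transition/bl_neg` = `Negative.conormalForm_bentSlope_neg`)
is a smooth EMBEDDING of the slice into the chart; ANY future unit normal field `ν` along it is the explicit one
`W/√(−g(W,W))`, `W = −g♯(dt* − T′dr)`, hence smooth as a section of `T(region)` along `ψ` (uniqueness of the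
future unit normal of a spacelike hypersurface); and there is an open connected `W ⊇ {t* ≥ T(r)}` — intended:
the TAPERED COLLAR `W = {x | t* > T(r) − (r − r₁)/4}` — in which `ψ(slice)` is a Cauchy hypersurface of
`(W, g|_W, τ|_W)` (met exactly once by every endless timelike curve of `W`): clocks `u = t* − T(r)` and
`w = u + (r − r₁)/4` are time functions (`dt* + c·dr` timelike on `r₋ < r < r₊` for `c ≤ ½`:
`conormalSq M a r z² (−c) ≤ −1`, TRIAGE r2-3 S1), `r` decreases along future causal curves in the hole
(Grönwall form `Kerr.horizonCovector_causal` + `delta_le_mul_sub_rPlus`, TRIAGE r2-1 S3), `|ẏ| ≤ ṫ*` gives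
`E4`-endpoints when `t*` is bounded, `T ≤ 2M log(r/M)` (`bentHeight_le_two_mul_log`) kills `t* → +∞` with
`u < 0`; case analysis of TRIAGE r2-1/2/3 (cards C/E/I).  Endpoint semantics: `HasFutureEndpoint` =
`Tendsto … atTop` on the subtype (curves on `[a,b]` have endpoints).  Size L.
[cite: ONeill1983, Ch. 14, Def. 14.28] [cite: arXiv08110354, §5.1] [cite: Sbierski2016AHP, §3.1] -/
theorem stub_shieldCollar :
    ∀ [Kerr.Facts] (M a r₁ : ℝ) (hM : 0 ≤ M), |a| < M → Kerr.rMinus M a < r₁ → r₁ < Kerr.rPlus M a →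
    ∀ (ν : NormalField 𝓘(ℝ, E4) (graph M a r₁)),
      (Kerr.smoothMetric M a r₁).IsFutureUnitNormal 𝓘(ℝ, E3) ((Kerr.timeOrientation M a r₁ hM).ofLE le_top)
        (graph M a r₁) ν →
    Manifold.IsSmoothEmbedding 𝓘(ℝ, E3) 𝓘(ℝ, E4) ∞ (graph M a r₁) ∧
    (∀ y, MDifferentiableAt 𝓘(ℝ, E3) 𝓘(ℝ, E4).tangent
      (fun y ↦ (TotalSpace.mk' E4 (graph M a r₁ y) (ν y) : TangentBundle 𝓘(ℝ, E4) (Kerr.region a r₁))) y) ∧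
    ∃ (W : TopologicalSpace.Opens (Kerr.region a r₁)) (hW : IsConnected (W : Set (Kerr.region a r₁)))
      (hι : ∀ y, graph M a r₁ y ∈ W),
      leafFuture M a r₁ ⊆ (W : Set (Kerr.region a r₁)) ∧
      (collarSpacetime M a r₁ hM W hW).metric.IsCauchyHypersurface
        (collarSpacetime M a r₁ hM W hW).timeOrientation (range (leafEmbed M a r₁ W hι)) := by
  sorry

/-- **Stub 5 — Kerr is Ricci-flat (the shared debt of every line; TRIAGE T7/L9, Disproof §H4).**  The `C^∞` Kerr
metric `Kerr.smoothMetric M a r₀ = (Kerr.metric M a r₀).ofLE le_top` (Kerr–Schild form `η + 2Hℓ⊗ℓ` on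
`{r > max r₀ 0}`) has `Ric = 0`, for all real `M, a, r₀` — the content of the UNPROVED named fact
`Kerr.isRicciFlat` (KerrSchild.lean), at the regularity the development structures consume.  Kerr–Schild 1965 §3
(`ℓ` geodesic shear-free null for `η` ⇒ `R_{μν}` linear in `H`; `H = Mr³/(r⁴+a²z²)` solves it); chart computation
via `ChartConnection.val_riemann_eq` / Koszul form, or the Kerr–Schild ansatz calculus.  The `a = 0` case is
`stub_ricciFlatKS` of the sibling crux's line `plug-the-second-sheet` — prove once in `Literature/…/KerrSchild*`
as `Kerr.isRicciFlat_holds` + `ofLE` transport.  Size L (mechanical).  [cite: KerrSchild1965, §3]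
[cite: ONeill1995, Ch. 2, Thm. 2.6.1] -/
theorem stub_kerrRicciFlat :
    ∀ [Kerr.Facts] (M a r₀ : ℝ) [(Kerr.smoothMetric M a r₀).HasLeviCivita] (x : Kerr.region a r₀),
      (Kerr.smoothMetric M a r₀).ricci x = 0 := by
  sorry

/-- **Stub 6 — inner-edge capping + transport: far sojourn completeness of a shielded sub-development gives
`HasCompleteNullInfinity` of the big development (where admissibility is consumed, Disproof §H1).**  Let `D` be
ADMISSIBLE on `X`, `φ : Kerr.slice a r₁ → X` a smooth open embedding with compact co-range carrying `D` to the exact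
leaf data (`φ^*h = ψ^*g`), `𝒲` ANY vacuum Cauchy development of `D.comap φ` with the far-sojourn property
(output of Stub 3), and `χ : 𝒲 → 𝒟` a smooth, isometric, time-orientation preserving open embedding over `φ`
(output of item 10053).  Then `𝒟` has complete future null infinity in the sojourn form, with
`B₀ := φ(far annulus)` and `B₁ := X ∖ φ({‖y‖ > R₁(s)})`.  Two halves: (a) CAPPING — `X ∖ φ({‖y‖ > R})` is compact
for every `R`: `(range φ)ᶜ` is compact, `φ({R' ≤ ‖y‖ ≤ R})` is compact, and the image of the inner collar
`{r₁ < r < r₁ + δ}` is precompact in `X` because its points are at bounded `h`-distance (`φ` is an `h`-isometry onto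
its open range; the leaf metric `δ + 2Hℓ⊗ℓ` is bounded near `r = r₁ > r₋ ≥ 0`, `T ≡ 0` there) from a fixed compact
set, while `h`-distance to chart-infinity of the sole DR end diverges (`AFEnd.isClosed_far`,
`isCompact_compl_far`, `h ≥ ½δ` far out) — no Hopf–Rinow (Disproof §H3 ≈ speed-limit card step (6)); (b) TRANSPORT
— a normalised null ray `γ` of `𝒟` from `ι(φ p)`: the component through `0` of `γ⁻¹(χ(𝒲))` pulls back along the
isometry `χ` to a MAXIMAL geodesic of `𝒲` from `𝒲.embed p` (uniqueness `IsGeodesicOn.eqOn_of_velocity_eq_holds`,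
Hausdorff, `leviCivita_comap_mpullback`), null, future, and normalised against `𝒲.normal p` because `dχ` maps the
future unit normal of `ι_𝒲(Σ)` to that of `ι(X)` at `ι(φ p)` (`mfderiv_normal_rel`); `χ(J⁺_𝒲(S)) ⊆ J⁺_𝒟(χ S)`
(`causalFuture_image_subset`, ConvergenceTransport) and `sojournTime_mono(_left)` finish.  Size L.
[cite: Christodoulou1999, pp. A26–A27] [cite: ONeill1983, Ch. 14, pp. 402–403] [cite: Bartnik1986, §1] -/
theorem stub_sojournTransport :
    ∀ [Kerr.Facts] (X : Type) [TopologicalSpace X] [ChartedSpace E3 X]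
      [IsManifold (𝓡 3) ∞ X] [T2Space X] [SecondCountableTopology X] [ConnectedSpace X]
      (D : InitialDataSet (𝓡 3) X), D ∈ admissibleVacuumData X →
    ∀ (M a r₁ : ℝ) [ConnectedSpace (Kerr.slice a r₁)] (φ : Kerr.slice a r₁ → X)
      (hφ : ContMDiff (𝓡 3) (𝓡 3) (((⊤ : ℕ∞) : WithTop ℕ∞) + 1) φ)
      (hφ' : ∀ u, Function.Injective (mfderiv (𝓡 3) (𝓡 3) φ u)),
      IsOpenEmbedding φ → IsCompact (Set.range φ)ᶜ →
      (∀ y : Kerr.slice a r₁,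
        pullbackBilin (I := 𝓡 3) (I' := 𝓘(ℝ, E3)) φ D.h.inner y =
          pullbackBilin (I := 𝓘(ℝ, E4)) (I' := 𝓘(ℝ, E3)) (graph M a r₁) (Kerr.smoothMetric M a r₁).val y) →
      |a| < M → Kerr.rMinus M a < r₁ → r₁ < Kerr.rPlus M a →
    ∀ (𝒲 : VacuumCauchyDevelopment (D.comap φ hφ hφ')),
      (∀ [hLC : 𝒲.metric.HasLeviCivita],
        ∃ R₀ : ℝ, IsCompact (farAnnulus a r₁ R₀) ∧
          ∀ s : ℝ, 0 < s → ∃ R₁ : ℝ, ∀ p : Kerr.slice a r₁, R₁ ≤ ‖(p : E3)‖ →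
            ∀ (γ : ℝ → 𝒲.carrier) (dom : Set ℝ),
              𝒲.metric.IsNormalisedNullRayFrom 𝒲.timeOrientation 𝒲.embed 𝒲.normal p γ dom →
                ¬ BddAbove dom ∨ ENNReal.ofReal s ≤ sojournTime γ dom
                  (𝒲.metric.causalFuture 𝒲.timeOrientation (𝒲.embed '' farAnnulus a r₁ R₀))) →
    ∀ (𝒟 : VacuumCauchyDevelopment D) (χ : 𝒲.carrier → 𝒟.carrier),
      ContMDiff (𝓡 4) (𝓡 4) ∞ χ → IsOpenEmbedding χ →
      𝒲.metric.IsIsometricImmersion 𝒟.metric.toPseudoRiemannianMetric χ →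
      𝒲.timeOrientation.PreservesTimeOrientation χ 𝒟.timeOrientation →
      χ ∘ 𝒲.embed = 𝒟.embed ∘ φ →
    Summit.FinalStateConjecture.HasCompleteNullInfinity 𝒟.toCauchyDevelopment := by
  sorry

/-- **Stub 7 — clauses (b)/(c): the `N = 1` decomposition with exhaustive charts, built inside `χ(W)` (sibling
line `one-gauge-sliding-seam` + Disproof §C1 last-exit + `ConvergenceTransport`; not this card's engine, stated
whole for the lead to merge with that line's skeleton).**  With `W`, `Σᵉ = leafEmbed(slice)` Cauchy in `W`, and
`χ : W → 𝒟` an isometric time-orientation preserving open embedding over `φ`: (1) LAST EXIT (§C1) —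
`exteriorOf 𝒟 (χ U) = χ({r > r₊, u ≥ 0} ∩ I⁻_W(U))` for `U ⊆ χ(W⁺)`, using only Cauchy-ness of `Σᵉ` in `W`,
acausality of the Cauchy hypersurface `ι(X)` of `𝒟`, Hausdorffness; (2) ONE GAUGE (§C3/§F, card
`one-gauge-sliding-seam`, TRIAGE N4/T5: `c₀ ≈ 4.74M`, `τ₀ ≥ 3`) — the receding-bend chart
`Φ(s, x) = χ(s + c₀ + T(r)·χ_cut((r − 2R(s))/R(s)), x)`, `R(s) = 3·max(s, …)`-type, is a late chart of the
sub-extremal Kerr background with `truncDeviationCk ≡ 0` eventually for every `R` (bend constant on the growing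
near zone — the STATIONARY bend is refuted: `Negative.not_tendsto_stationaryBend_dev`), the flat chart
`Φ|_{U₀}`, `U₀ = {s > τ₀ − 1, r > ρ(s)}`, `ρ = R − 1`, has `deviationCk → 0` (`O(M log R / R)`), images lie in
`{u ≥ 0} ⊆ W` because `T(3R(s)) ≤ 2M log(3R/M) ≤ s + c₀` (`bentHeight_le_two_mul_log`), and the `∀ τ₁` covering
/ `diff_subset_causalPast` hold by climbing the DRSR helix `∂_{t*} + ω(r)∂_φ` (`Kerr.isTimelike_drsrField`, all
`|a| < M`) to the single certified leaf (reflexive `J⁻`, Disproof §I); (3) TRANSPORT along `χ`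
(`Spacetime.deviation_comp`, `causalPast_image_subset`: only the easy inclusions are needed).  Size XL.
[cite: DafermosLuk2017, Conjecture 1] [cite: arXiv210408222, §1] [cite: arXiv08110354, §5.1] -/
theorem stub_exteriorCharts :
    ∀ [Kerr.Facts] (X : Type) [TopologicalSpace X] [ChartedSpace E3 X] [IsManifold (𝓡 3) ∞ X] [T2Space X]
      [SecondCountableTopology X] [ConnectedSpace X] (D : InitialDataSet (𝓡 3) X)
      (M a r₁ : ℝ) (hM : 0 ≤ M), |a| < M → Kerr.rMinus M a < r₁ → r₁ < Kerr.rPlus M a →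
    ∀ (φ : Kerr.slice a r₁ → X), IsOpenEmbedding φ → IsCompact (Set.range φ)ᶜ →
    ∀ (W : TopologicalSpace.Opens (Kerr.region a r₁)) (hW : IsConnected (W : Set (Kerr.region a r₁)))
      (hι : ∀ y, graph M a r₁ y ∈ W), leafFuture M a r₁ ⊆ (W : Set (Kerr.region a r₁)) →
      (collarSpacetime M a r₁ hM W hW).metric.IsCauchyHypersurface
        (collarSpacetime M a r₁ hM W hW).timeOrientation (range (leafEmbed M a r₁ W hι)) →
    ∀ (𝒟 : VacuumCauchyDevelopment D) (χ : (collarSpacetime M a r₁ hM W hW).carrier → 𝒟.carrier),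
      ContMDiff (𝓡 4) (𝓡 4) ∞ χ → IsOpenEmbedding χ →
      (collarSpacetime M a r₁ hM W hW).metric.IsIsometricImmersion 𝒟.metric.toPseudoRiemannianMetric χ →
      (collarSpacetime M a r₁ hM W hW).timeOrientation.PreservesTimeOrientation χ 𝒟.timeOrientation →
      χ ∘ leafEmbed M a r₁ W hι = 𝒟.embed ∘ φ →
    ∃ (O : Set 𝒟.carrier) (dec : FinalStateDecomposition 𝒟.toSpacetime O 2),
      (∀ i, Kerr.IsSubextremal (dec.mass i) (dec.spin i)) ∧
        O = Summit.FinalStateConjecture.exteriorOf 𝒟.toCauchyDevelopment dec.charted ∧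
          Summit.FinalStateConjecture.HasExhaustiveCharts dec := by
  sorry

/-! ## Sorry-free glue -/

/-- Injectivity of `dφ` from the shield's pull-back identity `φ^*h = ψ^*g` and spacelikeness of `ψ`
(`h(dφ v, dφ v) = g(dψ v, dψ v) > 0` for `v ≠ 0`). [folklore] -/
theorem injective_mfderiv_of_pullback_eq [Kerr.Facts] {X : Type} [TopologicalSpace X] [ChartedSpace E3 X]
    [IsManifold (𝓡 3) ∞ X] (D : InitialDataSet (𝓡 3) X) {M a r₁ : ℝ}
    {φ : Kerr.slice a r₁ → X} {ψ : Kerr.slice a r₁ → Kerr.region a r₁}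
    (hsp : (Kerr.smoothMetric M a r₁).IsSpacelikeImmersion 𝓘(ℝ, E3) ψ)
    (hh : ∀ y : Kerr.slice a r₁,
      pullbackBilin (I := 𝓡 3) (I' := 𝓘(ℝ, E3)) φ D.h.inner y =
        pullbackBilin (I := 𝓘(ℝ, E4)) (I' := 𝓘(ℝ, E3)) ψ (Kerr.smoothMetric M a r₁).val y)
    (u : Kerr.slice a r₁) : Function.Injective (mfderiv (𝓡 3) (𝓡 3) φ u) := by
  refine (injective_iff_map_eq_zero _).mpr fun v hv ↦ ?_
  by_contra hne
  have hpos := hsp.inducedBilin_pos u hne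
  rw [PseudoRiemannianMetric.inducedBilin_apply] at hpos
  -- the pull-back identity evaluated on `(v, v)` (both `pullbackBilin_apply`s hold by `rfl`)
  have key : D.h.inner (φ u) (mfderiv 𝓘(ℝ, E3) (𝓡 3) φ u v) (mfderiv 𝓘(ℝ, E3) (𝓡 3) φ u v) =
      (Kerr.smoothMetric M a r₁).val (ψ u) (mfderiv 𝓘(ℝ, E3) 𝓘(ℝ, E4) ψ u v)
        (mfderiv 𝓘(ℝ, E3) 𝓘(ℝ, E4) ψ u v) :=
    congrArg (fun B : E3 →L[ℝ] E3 →L[ℝ] ℝ ↦ B v v) (hh u)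
  have hv' : mfderiv 𝓘(ℝ, E3) (𝓡 3) φ u v = 0 := hv
  rw [hv', map_zero] at key
  exact (ne_of_lt hpos) key

/-- **Composition (kernel-checked; no `sorry` of its own).**  The seven registered stubs BY NAME and the route's
support item `SubdataDevelopmentsEmbed` (stmt-FinalStateConjecture-10053, the crux's declared dep, an admissible
hypothesis by name) give the crux BY NAME.  Shape:
`stub_twoSpeedOptics → stub_escape → stub_kerrSojourn`, `stub_shieldCollar + stub_kerrRicciFlat ⇒ 𝒲`,
`hSub ⇒ χ`, `stub_sojournTransport ⇒ clause (a)`, `stub_exteriorCharts ⇒ clauses (b)(c)`. [folklore] -/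
theorem KerrShieldedSettles_of
    (hSub : Summit.FinalStateConjecture.FinalStateConjecture.Theses.SwallowTheDatum.SubdataDevelopmentsEmbed) :
    Summit.FinalStateConjecture.FinalStateConjecture.Theses.SwallowTheDatum.KerrShieldedSettles := by
  -- the seven registered stubs, by name
  have h1 := @stub_twoSpeedOptics
  have h2 := @stub_escape
  have h3 := @stub_kerrSojourn
  have h4 := @stub_shieldCollar
  have h5 := @stub_kerrRicciFlat
  have h6 := @stub_sojournTransport
  have h7 := @stub_exteriorCharts
  intro inst X _ _ _ _ _ _ D hD hshield 𝒟 h𝒟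
  obtain ⟨M, a, r₁, hM, T, φ, ψ, ν, ha, hr₁, hr₂, hT, hKc, hopen, hφs, hψ, hsp, hν, hh, hk⟩ := hshield
  -- the graph clause pins `ψ` to the explicit leaf
  have hT' : T = bentHeight M a := hT.trans (bentHeight_eq_literal M a).symm
  obtain rfl : ψ = graph M a r₁ := psi_eq_graph hT' hψ
  haveI : ConnectedSpace (Kerr.slice a r₁) :=
    isConnected_iff_connectedSpace.mp (Kerr.isConnected_slice_holds a r₁)
  -- smoothness degree `∞ + 1 = ∞` and injectivity of `dφ`
  have hφ1 : ContMDiff (𝓡 3) (𝓡 3) (((⊤ : ℕ∞) : WithTop ℕ∞) + 1) φ := hφs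
  have hφ' : ∀ u, Function.Injective (mfderiv (𝓡 3) (𝓡 3) φ u) :=
    injective_mfderiv_of_pullback_eq D hsp hh
  -- Stub 4: the collar `W`, smoothness of the leaf embedding and of `ν`, Cauchy-ness
  obtain ⟨hemb, hνd, W, hW, hι, hsubW, hCauchy⟩ := h4 M a r₁ hM ha hr₁ hr₂ ν hν
  -- the exact slice data and its data embedding into the whole chart
  let Dₑ : InitialDataSet (𝓡 3) (Kerr.slice a r₁) := D.comap φ hφ1 hφ'
  let 𝒮K : DataEmbedding Dₑ :=
    { toSpacetime := Kerr.spacetime M a r₁ hM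
      embed := graph M a r₁
      isSmoothEmbedding := hemb
      normal := ν
      isFutureUnitNormal := hν
      induced_h := fun y ↦ by
        ext v w
        exact (congrArg (fun B : E3 →L[ℝ] E3 →L[ℝ] ℝ ↦ B v w) (hh y)).symm
      induced_k := by
        intro instLC y
        haveI : (Kerr.smoothMetric M a r₁).HasLeviCivita := instLC
        ext v w
        exact (congrArg (fun B ↦ B v w) (hk y)).symm }
  have hvac : 𝒮K.IsVacuum := by
    intro instLC x
    haveI : (Kerr.smoothMetric M a r₁).HasLeviCivita := instLC
    exact h5 M a r₁ x
  -- restriction to the collar: a vacuum Cauchy development of the exact slice data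
  let 𝒲 : VacuumCauchyDevelopment Dₑ :=
    { toDataEmbedding := 𝒮K.restrict W hW hι hνd
      isCauchyHypersurface := hCauchy
      isRicciFlat := by
        intro instLC
        haveI : (𝒮K.metric.restrict PseudoRiemannianMetric.contMDiff_restrict_holds
            W).toPseudoRiemannianMetric.HasLeviCivita := instLC
        exact 𝒮K.isRicciFlat_restrict W hvac }
  -- item 10053: the collar development embeds into the maximal development over `φ`
  obtain ⟨χ, hχs, hχo, hχi, hχt, hχe⟩ := hSub X D 𝒟 h𝒟 (Kerr.slice a r₁) φ hφ1 hφ' hopen 𝒲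
  refine ⟨?_, ?_⟩
  · -- clause (a): Stubs 1–3 give the far-sojourn property of `𝒲`, Stub 6 caps and transports it
    refine h6 X D hD M a r₁ φ hφ1 hφ' hopen hKc hh ha hr₁ hr₂ 𝒲 ?_ 𝒟 χ hχs hχo hχi hχt hχe
    intro hLC
    exact h3 h1 h2 M a r₁ hM ha hr₁ hr₂ W hW hι hsubW ν hν (hLC := hLC)
  · -- clauses (b), (c)
    exact h7 X D M a r₁ hM ha hr₁ hr₂ φ hopen hKc W hW hι hsubW hCauchy 𝒟 χ hχs hχo hχi hχt hχe

end Summit.FinalStateConjecture.FinalStateConjecture.Cruxes.KerrShieldedSettles.TwoSpeedOpticsSojourn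

end
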